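import Summits.Ventures.PercRepro.RankLevelSetCountBounds

/-!
# PercRepro — COUNTING THE `k`-SUBSETS OF A FINSET THAT MEET GIVEN SUBSETS (p8 g14, S3): the arithmetic of the spanning tail

The `k`-subsets of `E` (as sets, `ncard_subsets_ncard_eq_filter`) meeting both / one of two subsets `T₁, T₂`
(`card_filter_meets_two`, `card_filter_meets_one`), all / at least one / at least two of three (`card_filter_meets_three`,
`card_filter_meets_one_of_three`, `card_filter_meets_two_of_three_le`) — inclusion–exclusion over the «missing» families
`powersetCard k (E ∖ T)` (`filter_inter_eq_empty_eq_powersetCard_sdiff`, `powersetCard_sdiff_inter`), stated additively in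
`ℕ`. Consumed by RankLevelSetSpanningTriangles (the spanning tail cut by the triangles). Axioms: standard.
-/

namespace PercRepro

open Finset Set

variable {α : Type*}

/-! ### Counting the `k`-subsets of a finset that meet / miss given subsets -/

/-- The `k`-subsets of `E` (as sets of `α`) satisfying `P` number as many as the filtered `powersetCard`. -/
theorem ncard_subsets_ncard_eq_filter (E : Finset α) (k : ℕ) (P : Set α → Prop) [DecidablePred P] :
    {X : Set α | X ⊆ (E : Set α) ∧ X.ncard = k ∧ P X}.ncard =
      ((E.powersetCard k).filter (fun s : Finset α => P (s : Set α))).card := by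
  have himg : {X : Set α | X ⊆ (E : Set α) ∧ X.ncard = k ∧ P X} =
      (fun s : Finset α => (s : Set α)) ''
        (((E.powersetCard k).filter (fun s : Finset α => P (s : Set α)) : Finset (Finset α)) : Set (Finset α)) := by
    ext X
    simp only [Set.mem_setOf_eq, Set.mem_image, Finset.mem_coe, Finset.mem_filter, Finset.mem_powersetCard]
    constructor
    · rintro ⟨hXE, hXk, hP⟩
      have hXfin : X.Finite := (E.finite_toSet).subset hXE
      refine ⟨hXfin.toFinset, ⟨⟨?_, ?_⟩, ?_⟩, by simp⟩
      · intro x hx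
        exact Finset.mem_coe.1 (hXE ((Set.Finite.mem_toFinset hXfin).1 hx))
      · rw [← hXk, Set.ncard_eq_toFinset_card X hXfin]
      · rwa [Set.Finite.coe_toFinset]
    · rintro ⟨s, ⟨⟨hsE, hsk⟩, hP⟩, rfl⟩
      exact ⟨Finset.coe_subset.2 hsE, by rw [Set.ncard_coe_finset, hsk], hP⟩
  rw [himg, Set.ncard_image_of_injective _ Finset.coe_injective, Set.ncard_coe_finset]

section Count

variable [DecidableEq α]

/-- The `k`-subsets of `E` disjoint from `T` are the `k`-subsets of `E \ T`. -/
theorem filter_inter_eq_empty_eq_powersetCard_sdiff (E T : Finset α) (k : ℕ) :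
    (E.powersetCard k).filter (fun s : Finset α => s ∩ T = ∅) = (E \ T).powersetCard k := by
  ext s
  simp only [Finset.mem_filter, Finset.mem_powersetCard, Finset.subset_sdiff, Finset.disjoint_iff_inter_eq_empty]
  tauto

/-- **The `k`-subsets of `E` meeting both `T₁` and `T₂`**: `#hit + C(|E ∖ T₁|, k) + C(|E ∖ T₂|, k) = C(|E|, k) + C(|E ∖ (T₁ ∪ T₂)|, k)`. -/
theorem card_filter_meets_two (E T₁ T₂ : Finset α) (k : ℕ) :
    ((E.powersetCard k).filter (fun s : Finset α => (s ∩ T₁).Nonempty ∧ (s ∩ T₂).Nonempty)).card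
        + (E \ T₁).card.choose k + (E \ T₂).card.choose k
      = E.card.choose k + (E \ (T₁ ∪ T₂)).card.choose k := by
  have hneg : ((E.powersetCard k).filter (fun s : Finset α => (s ∩ T₁).Nonempty ∧ (s ∩ T₂).Nonempty)) =
      (E.powersetCard k).filter (fun s : Finset α => ¬ (s ∩ T₁ = ∅ ∨ s ∩ T₂ = ∅)) := by
    apply Finset.filter_congr
    intro s _
    simp only [Finset.nonempty_iff_ne_empty, not_or]
  have h1 := Finset.card_filter_add_card_filter_not (s := E.powersetCard k)
    (fun s : Finset α => (s ∩ T₁ = ∅ ∨ s ∩ T₂ = ∅))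
  have hor : (E.powersetCard k).filter (fun s : Finset α => (s ∩ T₁ = ∅ ∨ s ∩ T₂ = ∅)) =
      (E.powersetCard k).filter (fun s : Finset α => s ∩ T₁ = ∅) ∪
        (E.powersetCard k).filter (fun s : Finset α => s ∩ T₂ = ∅) := Finset.filter_or _ _ _
  have hand : (E.powersetCard k).filter (fun s : Finset α => s ∩ T₁ = ∅) ∩
      (E.powersetCard k).filter (fun s : Finset α => s ∩ T₂ = ∅) =
      (E.powersetCard k).filter (fun s : Finset α => s ∩ (T₁ ∪ T₂) = ∅) := by
    rw [← Finset.filter_and]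
    apply Finset.filter_congr
    intro s _
    rw [Finset.inter_union_distrib_left, Finset.union_eq_empty]
  have h2 := Finset.card_union_add_card_inter ((E.powersetCard k).filter (fun s : Finset α => s ∩ T₁ = ∅))
    ((E.powersetCard k).filter (fun s : Finset α => s ∩ T₂ = ∅))
  rw [hand, filter_inter_eq_empty_eq_powersetCard_sdiff, filter_inter_eq_empty_eq_powersetCard_sdiff,
    filter_inter_eq_empty_eq_powersetCard_sdiff, Finset.card_powersetCard, Finset.card_powersetCard,
    Finset.card_powersetCard] at h2
  rw [hor, filter_inter_eq_empty_eq_powersetCard_sdiff, filter_inter_eq_empty_eq_powersetCard_sdiff,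
    Finset.card_powersetCard] at h1
  rw [hneg]
  omega

/-- **The `k`-subsets of `E` meeting `T₁` or `T₂`**: `#hit + C(|E ∖ (T₁ ∪ T₂)|, k) = C(|E|, k)`. -/
theorem card_filter_meets_one (E T₁ T₂ : Finset α) (k : ℕ) :
    ((E.powersetCard k).filter (fun s : Finset α => (s ∩ T₁).Nonempty ∨ (s ∩ T₂).Nonempty)).card
        + (E \ (T₁ ∪ T₂)).card.choose k = E.card.choose k := by
  have hneg : ((E.powersetCard k).filter (fun s : Finset α => (s ∩ T₁).Nonempty ∨ (s ∩ T₂).Nonempty)) =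
      (E.powersetCard k).filter (fun s : Finset α => ¬ (s ∩ (T₁ ∪ T₂) = ∅)) := by
    apply Finset.filter_congr
    intro s _
    simp only [Finset.nonempty_iff_ne_empty, Finset.inter_union_distrib_left, Finset.union_eq_empty, not_and_or]
  have h1 := Finset.card_filter_add_card_filter_not (s := E.powersetCard k)
    (fun s : Finset α => s ∩ (T₁ ∪ T₂) = ∅)
  rw [filter_inter_eq_empty_eq_powersetCard_sdiff, Finset.card_powersetCard, Finset.card_powersetCard] at h1
  rw [hneg]
  omega

/-- The `k`-subsets of `E ∖ S` that are also `k`-subsets of `E ∖ S′` are the `k`-subsets of `E ∖ (S ∪ S′)`. -/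
theorem powersetCard_sdiff_inter (E S S' : Finset α) (k : ℕ) :
    (E \ S).powersetCard k ∩ (E \ S').powersetCard k = (E \ (S ∪ S')).powersetCard k := by
  ext s
  simp only [Finset.mem_inter, Finset.mem_powersetCard, Finset.subset_sdiff, Finset.disjoint_union_right]
  tauto

/-- **The `k`-subsets of `E` meeting all of `T₁`, `T₂`, `T₃`** (inclusion–exclusion over the three «missing» families):
`#hit + Σ_i C(|E ∖ T_i|, k) + C(|E ∖ (T₁ ∪ T₂ ∪ T₃)|, k) = C(|E|, k) + Σ_{i<j} C(|E ∖ (T_i ∪ T_j)|, k)`. -/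
theorem card_filter_meets_three (E T₁ T₂ T₃ : Finset α) (k : ℕ) :
    ((E.powersetCard k).filter
        (fun s : Finset α => (s ∩ T₁).Nonempty ∧ (s ∩ T₂).Nonempty ∧ (s ∩ T₃).Nonempty)).card
        + (E \ T₁).card.choose k + (E \ T₂).card.choose k + (E \ T₃).card.choose k
        + (E \ (T₁ ∪ T₂ ∪ T₃)).card.choose k
      = E.card.choose k + (E \ (T₁ ∪ T₂)).card.choose k + (E \ (T₁ ∪ T₃)).card.choose k
        + (E \ (T₂ ∪ T₃)).card.choose k := by
  have hneg : ((E.powersetCard k).filter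
      (fun s : Finset α => (s ∩ T₁).Nonempty ∧ (s ∩ T₂).Nonempty ∧ (s ∩ T₃).Nonempty)) =
      (E.powersetCard k).filter (fun s : Finset α => ¬ (s ∩ T₁ = ∅ ∨ s ∩ T₂ = ∅ ∨ s ∩ T₃ = ∅)) := by
    apply Finset.filter_congr
    intro s _
    simp only [Finset.nonempty_iff_ne_empty, not_or]
  have h1 := Finset.card_filter_add_card_filter_not (s := E.powersetCard k)
    (fun s : Finset α => (s ∩ T₁ = ∅ ∨ s ∩ T₂ = ∅ ∨ s ∩ T₃ = ∅))
  have hor : (E.powersetCard k).filter (fun s : Finset α => (s ∩ T₁ = ∅ ∨ s ∩ T₂ = ∅ ∨ s ∩ T₃ = ∅)) =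
      (E \ T₁).powersetCard k ∪ ((E \ T₂).powersetCard k ∪ (E \ T₃).powersetCard k) := by
    rw [Finset.filter_or, Finset.filter_or, filter_inter_eq_empty_eq_powersetCard_sdiff,
      filter_inter_eq_empty_eq_powersetCard_sdiff, filter_inter_eq_empty_eq_powersetCard_sdiff]
  rw [hor, Finset.card_powersetCard] at h1
  -- inclusion–exclusion for three families
  have hu1 := Finset.card_union_add_card_inter ((E \ T₁).powersetCard k)
    ((E \ T₂).powersetCard k ∪ (E \ T₃).powersetCard k)
  have hu2 := Finset.card_union_add_card_inter ((E \ T₂).powersetCard k) ((E \ T₃).powersetCard k)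
  rw [powersetCard_sdiff_inter, Finset.card_powersetCard, Finset.card_powersetCard, Finset.card_powersetCard] at hu2
  rw [Finset.inter_union_distrib_left, powersetCard_sdiff_inter, powersetCard_sdiff_inter,
    Finset.card_powersetCard] at hu1
  have hu3 := Finset.card_union_add_card_inter ((E \ (T₁ ∪ T₂)).powersetCard k)
    ((E \ (T₁ ∪ T₃)).powersetCard k)
  rw [powersetCard_sdiff_inter, show T₁ ∪ T₂ ∪ (T₁ ∪ T₃) = T₁ ∪ T₂ ∪ T₃ by
      ext x; simp only [Finset.mem_union]; tauto,
    Finset.card_powersetCard, Finset.card_powersetCard, Finset.card_powersetCard] at hu3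
  rw [hneg]
  omega

/-- **The `k`-subsets of `E` meeting at least one of `T₁`, `T₂`, `T₃`**: `#hit + C(|E ∖ (T₁ ∪ T₂ ∪ T₃)|, k) = C(|E|, k)`. -/
theorem card_filter_meets_one_of_three (E T₁ T₂ T₃ : Finset α) (k : ℕ) :
    ((E.powersetCard k).filter
        (fun s : Finset α => (s ∩ T₁).Nonempty ∨ (s ∩ T₂).Nonempty ∨ (s ∩ T₃).Nonempty)).card
        + (E \ (T₁ ∪ T₂ ∪ T₃)).card.choose k = E.card.choose k := by
  have hneg : ((E.powersetCard k).filter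
      (fun s : Finset α => (s ∩ T₁).Nonempty ∨ (s ∩ T₂).Nonempty ∨ (s ∩ T₃).Nonempty)) =
      (E.powersetCard k).filter (fun s : Finset α => ¬ (s ∩ (T₁ ∪ T₂ ∪ T₃) = ∅)) := by
    apply Finset.filter_congr
    intro s _
    simp only [Finset.nonempty_iff_ne_empty, Finset.inter_union_distrib_left, Finset.union_eq_empty, not_and_or]
    tauto
  have h1 := Finset.card_filter_add_card_filter_not (s := E.powersetCard k)
    (fun s : Finset α => s ∩ (T₁ ∪ T₂ ∪ T₃) = ∅)
  rw [filter_inter_eq_empty_eq_powersetCard_sdiff, Finset.card_powersetCard, Finset.card_powersetCard] at h1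
  rw [hneg]
  omega

/-- **The `k`-subsets of `E` meeting at least two of `T₁`, `T₂`, `T₃`** are among those meeting `T₁` or `T₂`:
`#hit + C(|E ∖ (T₁ ∪ T₂)|, k) ≤ C(|E|, k)`. -/
theorem card_filter_meets_two_of_three_le (E T₁ T₂ T₃ : Finset α) (k : ℕ) :
    ((E.powersetCard k).filter
        (fun s : Finset α => ((s ∩ T₁).Nonempty ∨ (s ∩ T₂).Nonempty) ∧ ((s ∩ T₁).Nonempty ∨ (s ∩ T₃).Nonempty) ∧
          ((s ∩ T₂).Nonempty ∨ (s ∩ T₃).Nonempty))).card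
        + (E \ (T₁ ∪ T₂)).card.choose k ≤ E.card.choose k := by
  have hsub : ((E.powersetCard k).filter
      (fun s : Finset α => ((s ∩ T₁).Nonempty ∨ (s ∩ T₂).Nonempty) ∧ ((s ∩ T₁).Nonempty ∨ (s ∩ T₃).Nonempty) ∧
        ((s ∩ T₂).Nonempty ∨ (s ∩ T₃).Nonempty))) ⊆
      (E.powersetCard k).filter (fun s : Finset α => (s ∩ T₁).Nonempty ∨ (s ∩ T₂).Nonempty) := by
    intro s hs
    rw [Finset.mem_filter] at hs ⊢
    exact ⟨hs.1, hs.2.1⟩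
  have := card_filter_meets_one E T₁ T₂ k
  have := Finset.card_le_card hsub
  omega

end Count

end PercRepro
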